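import Summits.QuantumFields.BalabanUV.Beta.GAN24.LinT2ZeroModeStep
import Summits.QuantumFields.BalabanUV.Beta.GAN24.Lin4Additive
import Summits.QuantumFields.BalabanUV.Beta.GAN24.LinSandwichShape
import Summits.QuantumFields.BalabanUV.Beta.GAN24.TransversalZeroModeLoc
import Summits.QuantumFields.BalabanUV.Beta.GAN24.WSlotFirstDiff
import Summits.QuantumFields.BalabanUV.Beta.GAN24.ZeroModeCoarseCount

/-!
# `BalabanUV.Beta.GAN24.Lin4ZeroMode` — binder row G-an2-4 / (CONV-C), W-slot road «W3» (SKELETON-W3 v1.0.2 §8.3, typer `LEAVES.md` v3.11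
# § IV-C), ROW W3-F2b `hZf` («W3-ZF*», leaf-18 gen 17), PART 1: **THE FIELD–FIELD ZERO MODE OF THE LINEAR PART `lin4 c K♮_j Lc` OF THE
# NORMALISED `T₂` RECURSION IS THE SAME AT EVERY STEP `j`** — so the map difference `(𝒜_{m+1} − 𝒜_m) X` is zero-mode-free, NO pin needed

NOT IN PRINT; OUR BOOKKEEPING (G-an2-4 formalisation swarm, leaf prover `b2b-balaban-gan24-formalise-leaf-18`, gen 17; journal INTENT «W3-ZF*»
l.9124; module name PROVISIONAL — the row owner gan24-p1 may rename ∕ re-home it).  HONEST FRAMING (cell contract, verbatim): «discharging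
`BetaPertH` makes Bałaban's UV stability UNCONDITIONAL — a real constructive-QFT result; it is NOT the continuum limit and NOT the Clay problem.»
HONEST DEPENDENCY (verbatim): «continuum YM on T⁴ ⇐ BetaPertH ∧ nine spine estimates (0/9 proved); BetaPertH ⇐ (D1) ∧ (D4) ∧ CAP+tail; G-an2-4
gates asym, D1 and NE2/3/4.»

CONTEXT.  Road «W3» writes the normalised Stage-B recursion as the affine tower `T♮_{j+1} = 𝒜_j T♮_j + b_j` with `𝒜_j = lin4 (cE₂·Lc^{2(d+1)}) K♮_j Lc`,
`K♮_j = unitK (Lc^j) (Lc^{j(d+1)}) (KInvStep Lc j)` (leaf-04's `T2RecursionAffine`, leaf-01's `AffineUnroll`∕`T2UnitSplitLevels`).  The END #2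
`WSlotT2OfPieces.t2Drift_of_rows` (owner) runs the DIFFERENCE tower with forcing `f m := (𝒜_{m+1} − 𝒜_m) T♮_m + (b_{m+1} − b_m)` and needs
`hZf : ∀ m, Zfree (f m)` (ROW W3-F2b).  Its map half is THIS file: by leaf-02's (Z0) (`LinT2ZeroMode` ∕ `LinT2ZeroModeStep`: the field–field zero
mode of the bi-vertex sandwich `linT2 K♮_j Lc X` is `−Lc^{−4(d+2)} · Z_ff(X)` AT EVERY `j`), the zero mode of `𝒜_j X` does not depend on `j`, hence
`Z_ff((𝒜_{m+1} − 𝒜_m) X) = (λ − λ)·Z_ff(X) = 0` with NO pin and NO hypothesis on `Z_ff(X)` (RULINGS-14d; contrast ROW W3-F4d, which needs λ = 1).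
[folklore] algebra over leaf-02∕04∕10∕16∕an2's DEFINED objects and tree theorems, all BY NAME; generic `d`, `1 ≤ Lc`, every `j`; 0 `def`, 0 cite,
0 `def … : Prop`, 0 sorry.

WHAT.
* §1 `lin4_translate` (coarse `1`-covariance of `lin4 c K N X` from block covariance of `K` and joint `N`-covariance of `X`);
  **`lin4_eq_smul_linT2_add`**: `lin4 c K N X μ y ν y′ = (−c/2) • (linT2 K N X μ y ν y′ + linT2 K N X ν y′ μ y)` on bounded tables (leaf-04's
  `vsym = ½(V + V_swap)` through `comp_add_right`∕`comp_add_left`∕`mmRead_add`); `locStencil₂_mmRead_sandwich_of_pair` (a family bi-localised at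
  `(N•y, N•y′)` AND `(N•y′, N•y)` sandwiches to a `LocStencil₂` table — leaf-10's `LinSandwichShape` route for a general family), whence
  `locStencil₂_linT2`, `locStencil₂_linT2_swap`; `locStencil₂_lin4` (= leaf-10's `locStencil₂_lin_step` against the name `lin4`).
* §2 **`zmode_one_lin4_step`**: `zmode 1 (lin4 c K♮_j Lc X) μ ν (inl α) (inl β) = c·½·Lc^{−4(d+2)}·(zmode Lc X μ ν (inl α) (inl β) + zmode Lc X ν μ (inl α) (inl β))`
  for EVERY jointly `Lc`-covariant `LocStencil₂` table `X` and EVERY `j`; pointwise form `inner_lin4_step` (any coarse first bond), cell form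
  `zmode_lin4_step` (any period); hence **`inner_lin4_sub_lin4_step`** ∕ **`zmode_lin4_sub_lin4_step`**: `(lin4 c K♮_i Lc X − lin4 c K♮_j Lc X)` has
  vanishing field–field transversal inner sums at every bond and vanishing cell zero mode at every period — BOTH `Zfree` instantiations on the table
  (pointwise = OF RECORD, ref2 R51-2 ∕ (w2); cell = RULINGS-14b (R14-6)).
PART 2 (`GAN24/WSlotForcingZeroMode`) adds the source difference under ROW W3-F2a and states `hZf` literally.  Asserts NO shape or rate of Bałaban's
tables; discharges NOTHING of «T2Shape» ∕ «T2SupRate» ∕ (hW, hWall); `hpin` not used; 0 wall binders instantiated; NOT «W-slot closed», NEVER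
«G-an2-4 closed»; NOT BetaPertH, NOT continuum, NOT Clay.
-/

noncomputable section

open Finset
open scoped BigOperators
open Literature.MathematicalPhysics.QuantumFieldTheory
open Literature.MathematicalPhysics.QuantumFieldTheory.Balaban1983to89
open Literature.MathematicalPhysics.QuantumFieldTheory.Balaban1983to89.Beta
open B12Sec2to5 (l1 l1_nonneg)
open ExpKernelCalculus (MKer Decays BiLoc VertexFamily₂ comp shiftK Zl Zl_nonneg)
open OneStepResolventKernel (Fib decays_mono)
open OneStepKernelFamily (KInvStep shiftK_KInvStep decays_KInvStep)
open StepJetData (comp_add_right)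
open BalabanCompositeJets (LocStencil₂)
open SecondOrderResponse (vertex2OfK vertex2OfK_translate vertexFamily₂_vertex2OfK vertexFamily₂_vertex2OfK_swap cBi cBi_nonneg
  biLoc_sandwich)
open KernelWard (Bdd)
open BalabanStepJetsSucc (mmRead biLoc_mmRead mmRead_shiftK_smul comp_sandwich_shiftK l1_sub_le_l1_smul_sub)
open BalabanStepW2 (biLoc_far_of_pair biLoc_le_mono)
open Summit.QuantumFields.BalabanUV.Beta.VertexReflectionContact (comp_add_left mmRead_add)
open Summit.QuantumFields.BalabanUV.Beta.HessKerDressedUnits (unitK decays_unitK)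
open Summit.QuantumFields.BalabanUV.Beta.GAN24.CombesThomas (sfStep smStep)
open Summit.QuantumFields.BalabanUV.Beta.GAN24.ThirdJetKernel (mmRead_smul)
open Summit.QuantumFields.BalabanUV.Beta.GAN24.T2RecursionAffine (vsym lin4 lin4_apply)
open Summit.QuantumFields.BalabanUV.Beta.GAN24.Lin4Additive (abs_vertex2OfK_le summable_slices_decays_bdd summable_slices_bdd_decays
  bdd_comp_decays_bdd)
open Summit.QuantumFields.BalabanUV.Beta.GAN24.LinSandwichShape (locStencil₂_lin_step)
open Summit.QuantumFields.BalabanUV.Beta.GAN24.BiStencilZeroMode (Tab zmode zmode_one)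
open Summit.QuantumFields.BalabanUV.Beta.GAN24.LinT2ZeroMode (linT2 linT2_translate zmode_one_swap)
open Summit.QuantumFields.BalabanUV.Beta.GAN24.LinT2ZeroModeStep (shiftK_unitK zmode_one_linT2_unitKInvStep_step')
open Summit.QuantumFields.BalabanUV.Beta.GAN24.TransversalZeroMode (zmode_eq_zero_of_inner_eq_zero)
open Summit.QuantumFields.BalabanUV.Beta.GAN24.TransversalZeroModeLoc (inner_sub_of_locStencil₂)
open Summit.QuantumFields.BalabanUV.Beta.GAN24.WSlotFirstDiff (zmode_smul zmode_add)
open Summit.QuantumFields.BalabanUV.Beta.GAN24.ZeroModeCoarseCount (inner_const_of_unit_cov zmode_eq_pow_mul_zmode_one)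

namespace Summit.QuantumFields.BalabanUV.Beta.GAN24.Lin4ZeroMode

variable {d : ℕ}

/-! ## §1 The linear part `lin4`: coarse covariance, the split into the two bi-vertex sandwiches, and their shapes -/

/-- [folklore] A `LocStencil₂` table (rate `δ ≥ 0`) has entries bounded by its constant. -/
theorem bdd_of_locStencil₂ {X : Tab d} {C δ : ℝ} (hX : LocStencil₂ X C δ) (hδ : 0 ≤ δ) (κ : Fin (d + 1)) (u : Fin (d + 1) → ℤ)
    (κ' : Fin (d + 1)) (u' x z : Fin (d + 1) → ℤ) (a b : Fib d) : |X κ u κ' u' x z a b| ≤ C := by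
  have hC : 0 ≤ C := hX.nonneg
  have h := hX κ u κ' u' x z a b
  have e1 : Real.exp (-δ * l1 (u' - u)) ≤ 1 := Real.exp_le_one_iff.mpr (by nlinarith [l1_nonneg (u' - u)])
  have e2 : Real.exp (-δ * (l1 (x - u) + l1 (z - u))) ≤ 1 :=
    Real.exp_le_one_iff.mpr (by nlinarith [l1_nonneg (x - u), l1_nonneg (z - u)])
  calc |X κ u κ' u' x z a b| ≤ C * Real.exp (-δ * l1 (u' - u)) * Real.exp (-δ * (l1 (x - u) + l1 (z - u))) := h
    _ ≤ C * 1 * 1 := by gcongr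
    _ = C := by ring

/-- [folklore] **COARSE COVARIANCE OF `lin4`**: a block-covariant `K` (blocking `N`) and a jointly `N`-covariant table `X` give a jointly
`1`-covariant `lin4 c K N X` on the coarse lattice (an2's `vertex2OfK_translate` for the bi-vertex and its swap ⨾ `comp_sandwich_shiftK` ⨾
`mmRead_shiftK_smul`; cf. leaf-02's `LinT2ZeroMode.linT2_translate`). -/
theorem lin4_translate {K : MKer (d + 1) (Fib d)} {N : ℕ} (hKcov : ∀ t, shiftK (-((N : ℤ) • t)) K = K) (c : ℝ) {X : Tab d}
    (hXcov : ∀ κ u κ' u' t, X κ (u + (N : ℤ) • t) κ' (u' + (N : ℤ) • t) = shiftK (-((N : ℤ) • t)) (X κ u κ' u'))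
    (μ : Fin (d + 1)) (y : Fin (d + 1) → ℤ) (ν : Fin (d + 1)) (y' t : Fin (d + 1) → ℤ) :
    lin4 c K N X μ (y + t) ν (y' + t) = shiftK (-t) (lin4 c K N X μ y ν y') := by
  have hv : vsym K N X μ (y + t) ν (y' + t) = shiftK (-((N : ℤ) • t)) (vsym K N X μ y ν y') := by
    simp only [vsym]
    rw [vertex2OfK_translate hKcov hXcov, vertex2OfK_translate hKcov hXcov]
    funext x z a b
    simp only [Pi.smul_apply, Pi.add_apply, shiftK, smul_eq_mul]
  rw [lin4_apply, lin4_apply, hv, comp_sandwich_shiftK (hKcov t), mmRead_shiftK_smul]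
  funext x z a b
  simp only [Pi.neg_apply, Pi.smul_apply, shiftK, smul_eq_mul]

/-- [folklore] **`lin4` = `−c/2 ·` (BI-VERTEX SANDWICH + ITS SWAP)** on bounded tables: for a decaying `K` (rate `δ > 0`) and a table `X`
with bounded entries, `lin4 c K N X μ y ν y′ = (−(c·½)) • (linT2 K N X μ y ν y′ + linT2 K N X ν y′ μ y)` — leaf-04's `vsym = ½(V + V_swap)`
pushed through the two kernel compositions (`StepJetData.comp_add_right`, `VertexReflectionContact.comp_add_left`, slices summable by
leaf-01's `Lin4Additive.summable_slices_*`) and the pointwise `mmRead` (leaf-02 l.8615: «the bridge to `lin4` is one `funext`+`ring` away»). -/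
theorem lin4_eq_smul_linT2_add {K : MKer (d + 1) (Fib d)} {C δ : ℝ} (hK : Decays K C δ) (hδ : 0 < δ) (c : ℝ) (N : ℕ)
    {X : Tab d} {B : ℝ} (hX : ∀ κ u κ' u' x z a b, |X κ u κ' u' x z a b| ≤ B)
    (μ : Fin (d + 1)) (y : Fin (d + 1) → ℤ) (ν : Fin (d + 1)) (y' : Fin (d + 1) → ℤ) :
    lin4 c K N X μ y ν y' = (-(c * (1 / 2 : ℝ))) • (linT2 K N X μ y ν y' + linT2 K N X ν y' μ y) := by
  have hV : Bdd (vertex2OfK K N X μ y ν y') _ := fun x z a b => abs_vertex2OfK_le hK hδ N hX μ y ν y' x z a b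
  have hV' : Bdd (vertex2OfK K N X ν y' μ y) _ := fun x z a b => abs_vertex2OfK_le hK hδ N hX ν y' μ y x z a b
  have h1 : comp K (vertex2OfK K N X μ y ν y' + vertex2OfK K N X ν y' μ y) =
      comp K (vertex2OfK K N X μ y ν y') + comp K (vertex2OfK K N X ν y' μ y) :=
    comp_add_right (summable_slices_decays_bdd hK hδ hV) (summable_slices_decays_bdd hK hδ hV')
  have h2 : comp (comp K (vertex2OfK K N X μ y ν y') + comp K (vertex2OfK K N X ν y' μ y)) K =
      comp (comp K (vertex2OfK K N X μ y ν y')) K + comp (comp K (vertex2OfK K N X ν y' μ y)) K :=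
    comp_add_left (summable_slices_bdd_decays (bdd_comp_decays_bdd hK hδ hV) hK hδ)
      (summable_slices_bdd_decays (bdd_comp_decays_bdd hK hδ hV') hK hδ)
  rw [lin4_apply]
  simp only [vsym]
  rw [KernelReflection.comp_smul_right, h1, KernelReflection.comp_smul_left, h2, mmRead_smul, mmRead_add]
  funext x z a b
  simp only [linT2, Pi.neg_apply, Pi.smul_apply, Pi.add_apply, smul_eq_mul]
  ring

/-- [folklore] **A SANDWICH OF A PAIR-LOCALISED FAMILY IS `LocStencil₂`** (leaf-10's `LinSandwichShape.locStencil₂_mmRead_sandwich_vsym`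
for a general family): if `W μ y ν y′` is bi-localised at `(N•y, N•y′)` AND at `(N•y′, N•y)` (constant `Cw`, rate `m₀/8`) for a `K`
decaying at `(CK, m₀)`, then `(μ, y, ν, y′) ↦ mmRead N (K ∘ W μ y ν y′ ∘ K)` is `LocStencil₂` at rate `m₀/128` (an2's `biLoc_far_of_pair` ⨾
`biLoc_sandwich` ⨾ `biLoc_mmRead`). -/
theorem locStencil₂_mmRead_sandwich_of_pair {K : MKer (d + 1) (Fib d)} {CK m₀ : ℝ} (hK : Decays K CK m₀) (hCK : 0 ≤ CK)
    (hm₀ : 0 < m₀) {N : ℕ} (hN : 1 ≤ N) {W : Tab d} {Cw : ℝ} (hCw : 0 ≤ Cw)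
    (hW₁ : ∀ μ y ν y', BiLoc (W μ y ν y') ((N : ℤ) • y) ((N : ℤ) • y') Cw (m₀ / 8))
    (hW₂ : ∀ μ y ν y', BiLoc (W μ y ν y') ((N : ℤ) • y') ((N : ℤ) • y) Cw (m₀ / 8)) :
    LocStencil₂ (fun μ y ν y' => mmRead N (comp (comp K (W μ y ν y')) K))
      ((Fintype.card (Fib d) : ℝ) * ((Fintype.card (Fib d) : ℝ) * (CK * Cw) * Zl (d + 1) (m₀ / 32 / 2) * CK) *
        Zl (d + 1) (m₀ / 32 / 4)) (m₀ / 128) := by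
  have hK₃₂ : Decays K CK (m₀ / 32) := decays_mono hK hCK le_rfl (by linarith)
  have hZa := Zl_nonneg (D := d + 1) (show 0 < m₀ / 32 / 2 by positivity)
  have hZb := Zl_nonneg (D := d + 1) (show 0 < m₀ / 32 / 4 by positivity)
  intro κ u κ' u'
  have h3 := biLoc_far_of_pair (hW₁ κ u κ' u') (hW₂ κ u κ' u') (show (0 : ℝ) ≤ m₀ / 8 by positivity)
  rw [show m₀ / 8 / 2 = m₀ / 16 by ring, show m₀ / 8 / 4 = m₀ / 32 by ring] at h3
  have hS := biLoc_sandwich hK₃₂ hCK (by positivity) h3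
  have hS' : BiLoc (comp (comp K (W κ u κ' u')) K) ((N : ℤ) • u) ((N : ℤ) • u)
      ((Fintype.card (Fib d) : ℝ) * ((Fintype.card (Fib d) : ℝ) *
        (CK * (Cw * Real.exp (-(m₀ / 16) * l1 ((N : ℤ) • u' - (N : ℤ) • u)))) * Zl (d + 1) (m₀ / 32 / 2) * CK) *
        Zl (d + 1) (m₀ / 32 / 4)) (m₀ / 32 / 4) := by
    intro x z a b
    have h := hS x z a b
    rwa [abs_neg] at h
  have hR := biLoc_mmRead hN hS' (by positivity)
  refine biLoc_le_mono hR (by positivity) ?_ (le_of_eq (by ring))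
  have hexp : Real.exp (-(m₀ / 16) * l1 ((N : ℤ) • u' - (N : ℤ) • u)) ≤ Real.exp (-(m₀ / 128) * l1 (u' - u)) :=
    Real.exp_le_exp.2 (by nlinarith [l1_sub_le_l1_smul_sub hN u' u, l1_nonneg (u' - u)])
  calc (Fintype.card (Fib d) : ℝ) * ((Fintype.card (Fib d) : ℝ) *
        (CK * (Cw * Real.exp (-(m₀ / 16) * l1 ((N : ℤ) • u' - (N : ℤ) • u)))) * Zl (d + 1) (m₀ / 32 / 2) * CK) *
        Zl (d + 1) (m₀ / 32 / 4)
      = (Fintype.card (Fib d) : ℝ) * ((Fintype.card (Fib d) : ℝ) * (CK * Cw) * Zl (d + 1) (m₀ / 32 / 2) * CK) *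
          Zl (d + 1) (m₀ / 32 / 4) * Real.exp (-(m₀ / 16) * l1 ((N : ℤ) • u' - (N : ℤ) • u)) := by ring
    _ ≤ (Fintype.card (Fib d) : ℝ) * ((Fintype.card (Fib d) : ℝ) * (CK * Cw) * Zl (d + 1) (m₀ / 32 / 2) * CK) *
          Zl (d + 1) (m₀ / 32 / 4) * Real.exp (-(m₀ / 128) * l1 (u' - u)) :=
        mul_le_mul_of_nonneg_left hexp (by positivity)

/-- [folklore] **THE BI-VERTEX SANDWICH `linT2 K N X` IS `LocStencil₂`** for a decaying `K` and a `LocStencil₂` table `X` (rate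
`min m δ / 128`): an2's `vertexFamily₂_vertex2OfK` at `(N•y, N•y′)` and `vertexFamily₂_vertex2OfK_swap` read at `(N•y′, N•y)` are the pair. -/
theorem locStencil₂_linT2 {K : MKer (d + 1) (Fib d)} {CK m : ℝ} (hK : Decays K CK m) (hCK : 0 ≤ CK) (hm : 0 < m) {N : ℕ} (hN : 1 ≤ N)
    {X : Tab d} {C δ : ℝ} (hX : LocStencil₂ X C δ) (hδ : 0 < δ) :
    LocStencil₂ (linT2 K N X)
      ((Fintype.card (Fib d) : ℝ) * ((Fintype.card (Fib d) : ℝ) * (CK * cBi d CK C (min m δ)) * Zl (d + 1) (min m δ / 32 / 2) * CK) *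
        Zl (d + 1) (min m δ / 32 / 4)) (min m δ / 128) := by
  have hC : 0 ≤ C := hX.nonneg
  have hm₀ : 0 < min m δ := lt_min hm hδ
  have hK₀ : Decays K CK (min m δ) := decays_mono hK hCK le_rfl (min_le_left _ _)
  have hX₀ : LocStencil₂ X C (min m δ) := hX.mono (min_le_right _ _)
  have h1 := vertexFamily₂_vertex2OfK (N := N) hK₀ hCK hX₀ hm₀
  have h2 := vertexFamily₂_vertex2OfK_swap (N := N) hK₀ hCK hX₀ hm₀
  exact locStencil₂_mmRead_sandwich_of_pair hK₀ hCK hm₀ hN (cBi_nonneg hCK hC hm₀) (fun μ y ν y' => h1 μ y ν y')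
    (fun μ y ν y' => h2 ν y' μ y)

/-- [folklore] **THE SWAPPED SANDWICH `(μ, y, ν, y′) ↦ linT2 K N X ν y′ μ y` IS `LocStencil₂`** (same constant and rate; the pair is
`vertexFamily₂_vertex2OfK_swap` at `(N•y, N•y′)` and `vertexFamily₂_vertex2OfK` read at `(N•y′, N•y)`). -/
theorem locStencil₂_linT2_swap {K : MKer (d + 1) (Fib d)} {CK m : ℝ} (hK : Decays K CK m) (hCK : 0 ≤ CK) (hm : 0 < m) {N : ℕ}
    (hN : 1 ≤ N) {X : Tab d} {C δ : ℝ} (hX : LocStencil₂ X C δ) (hδ : 0 < δ) :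
    LocStencil₂ (fun μ y ν y' => linT2 K N X ν y' μ y)
      ((Fintype.card (Fib d) : ℝ) * ((Fintype.card (Fib d) : ℝ) * (CK * cBi d CK C (min m δ)) * Zl (d + 1) (min m δ / 32 / 2) * CK) *
        Zl (d + 1) (min m δ / 32 / 4)) (min m δ / 128) := by
  have hC : 0 ≤ C := hX.nonneg
  have hm₀ : 0 < min m δ := lt_min hm hδ
  have hK₀ : Decays K CK (min m δ) := decays_mono hK hCK le_rfl (min_le_left _ _)
  have hX₀ : LocStencil₂ X C (min m δ) := hX.mono (min_le_right _ _)
  have h1 := vertexFamily₂_vertex2OfK (N := N) hK₀ hCK hX₀ hm₀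
  have h2 := vertexFamily₂_vertex2OfK_swap (N := N) hK₀ hCK hX₀ hm₀
  exact locStencil₂_mmRead_sandwich_of_pair (W := fun μ y ν y' => vertex2OfK K N X ν y' μ y) hK₀ hCK hm₀ hN
    (cBi_nonneg hCK hC hm₀) (fun μ y ν y' => h2 μ y ν y') (fun μ y ν y' => h1 ν y' μ y)

/-- [folklore] **`lin4 c K N X` IS `LocStencil₂`** — leaf-10's `LinSandwichShape.locStencil₂_lin_step` (LITERALLY the body of `lin4`, by
`rfl` on leaf-04's `lin4`∕`vsym`), re-typed against the name `lin4`. -/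
theorem locStencil₂_lin4 {K : MKer (d + 1) (Fib d)} {CK m : ℝ} (hK : Decays K CK m) (hCK : 0 ≤ CK) (hm : 0 < m) {N : ℕ} (hN : 1 ≤ N)
    (c : ℝ) {X : Tab d} {C δ : ℝ} (hX : LocStencil₂ X C δ) (hδ : 0 < δ) :
    LocStencil₂ (lin4 c K N X)
      (|c| * ((Fintype.card (Fib d) : ℝ) * ((Fintype.card (Fib d) : ℝ) * (CK * cBi d CK 1 (min m δ)) * Zl (d + 1) (min m δ / 32 / 2) * CK) *
          Zl (d + 1) (min m δ / 32 / 4) * C))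
      (min m δ / 128) :=
  locStencil₂_lin_step hK hCK hm hN c hX hδ

/-! ## §2 The zero mode of `lin4` through the dressed step kernel `K♮_j` is `j`-FREE -/

section Core

variable {Lc : ℕ} [NeZero Lc]

/-- [folklore] The dressed step kernel `K♮_j = unitK (Lc^j) (Lc^{j(d+1)}) (KInvStep Lc j)` is block covariant at blocking `Lc`. -/
theorem shiftK_unitKInvStep (j : ℕ) (t : Fin (d + 1) → ℤ) :
    shiftK (-((Lc : ℤ) • t)) (unitK (sfStep Lc j) (smStep d Lc j) (KInvStep (d := d) Lc j))
      = unitK (sfStep Lc j) (smStep d Lc j) (KInvStep (d := d) Lc j) := by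
  rw [shiftK_unitK, shiftK_KInvStep]

/-- **THE PERIOD-1 ZERO MODE OF THE LINEAR PART IS `j`-FREE** [folklore over leaf-02's (Z0)]: for every `LocStencil₂` (`δ > 0`) jointly
`Lc`-covariant table `X`, every scalar `c` and EVERY step `j`,
`zmode 1 (lin4 c K♮_j Lc X) μ ν (inl α) (inl β) = c · ½ · Lc^{−4(d+2)} · (zmode Lc X μ ν (inl α) (inl β) + zmode Lc X ν μ (inl α) (inl β))`
— the split of §1, `WSlotFirstDiff.zmode_add`∕`zmode_smul` (the two sandwiches are `LocStencil₂` by §1), leaf-02's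
`LinT2ZeroModeStep.zmode_one_linT2_unitKInvStep_step'` (factor `−Lc^{−4(d+2)}` at every `j`) and `LinT2ZeroMode.zmode_one_swap`.
The right-hand side does not mention `j`: this is the whole content of ROW W3-F2b (RULINGS-14d: «λ is m-FREE — NO pin needed»). -/
theorem zmode_one_lin4_step (hLc : 1 ≤ Lc) (j : ℕ) (c : ℝ) {X : Tab d} {CT δ : ℝ} (hX : LocStencil₂ X CT δ) (hδ : 0 < δ)
    (hXcov : ∀ κ u κ' u' t, X κ (u + (Lc : ℤ) • t) κ' (u' + (Lc : ℤ) • t) = shiftK (-((Lc : ℤ) • t)) (X κ u κ' u'))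
    (μ ν α β : Fin (d + 1)) :
    zmode 1 (lin4 c (unitK (sfStep Lc j) (smStep d Lc j) (KInvStep (d := d) Lc j)) Lc X) μ ν (Sum.inl α) (Sum.inl β)
      = c * ((1 / 2 : ℝ) * (((Lc : ℝ) ^ (d + 1 + 1))⁻¹) ^ 4) *
          (zmode Lc X μ ν (Sum.inl α) (Sum.inl β) + zmode Lc X ν μ (Sum.inl α) (Sum.inl β)) := by
  obtain ⟨m, C, hm, hC, hK⟩ := decays_KInvStep (Lc := Lc) (d := d) j
  have hKu := decays_unitK (sf := sfStep Lc j) (sm := smStep d Lc j) hK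
  have hCu : 0 ≤ max |sfStep Lc j| |smStep d Lc j| * C * max |sfStep Lc j| |smStep d Lc j| := by positivity
  have hKcov : ∀ t, shiftK (-((Lc : ℤ) • t)) (unitK (sfStep Lc j) (smStep d Lc j) (KInvStep (d := d) Lc j))
      = unitK (sfStep Lc j) (smStep d Lc j) (KInvStep (d := d) Lc j) := shiftK_unitKInvStep j
  have hB := bdd_of_locStencil₂ hX hδ.le
  have e : lin4 c (unitK (sfStep Lc j) (smStep d Lc j) (KInvStep (d := d) Lc j)) Lc X = fun μ y ν y' =>
      (-(c * (1 / 2 : ℝ))) •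
        (linT2 (unitK (sfStep Lc j) (smStep d Lc j) (KInvStep (d := d) Lc j)) Lc X μ y ν y'
          + (fun μ y ν y' => linT2 (unitK (sfStep Lc j) (smStep d Lc j) (KInvStep (d := d) Lc j)) Lc X ν y' μ y) μ y ν y') := by
    funext μ y ν y'
    exact lin4_eq_smul_linT2_add hKu hm c Lc hB μ y ν y'
  have hL₁ := locStencil₂_linT2 hKu hCu hm hLc hX hδ
  have hL₂ := locStencil₂_linT2_swap hKu hCu hm hLc hX hδ
  have hr : 0 < min m δ / 128 := by positivity
  rw [e, zmode_smul, zmode_add hL₁ hL₂ hr, zmode_one_linT2_unitKInvStep_step' j hX hδ hXcov μ ν α β,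
    zmode_one_swap _ (linT2_translate hKcov hXcov), zmode_one_linT2_unitKInvStep_step' j hX hδ hXcov ν μ α β]
  ring

/-- **POINTWISE FORM** [folklore]: the transversal inner sum of `lin4 c K♮_j Lc X` at ANY coarse first bond `(μ, y)` equals the `j`-free
right-hand side of `zmode_one_lin4_step` (the coarse output is `1`-covariant by `lin4_translate`, so the inner sum is constant in `y`:
`ZeroModeCoarseCount.inner_const_of_unit_cov`, then `zmode_one`). -/
theorem inner_lin4_step (hLc : 1 ≤ Lc) (j : ℕ) (c : ℝ) {X : Tab d} {CT δ : ℝ} (hX : LocStencil₂ X CT δ) (hδ : 0 < δ)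
    (hXcov : ∀ κ u κ' u' t, X κ (u + (Lc : ℤ) • t) κ' (u' + (Lc : ℤ) • t) = shiftK (-((Lc : ℤ) • t)) (X κ u κ' u'))
    (μ : Fin (d + 1)) (y : Fin (d + 1) → ℤ) (ν α β : Fin (d + 1)) :
    (∑' y', ∑' x', ∑' z', lin4 c (unitK (sfStep Lc j) (smStep d Lc j) (KInvStep (d := d) Lc j)) Lc X μ y ν y' x' z'
        (Sum.inl α) (Sum.inl β))
      = c * ((1 / 2 : ℝ) * (((Lc : ℝ) ^ (d + 1 + 1))⁻¹) ^ 4) *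
          (zmode Lc X μ ν (Sum.inl α) (Sum.inl β) + zmode Lc X ν μ (Sum.inl α) (Sum.inl β)) := by
  rw [inner_const_of_unit_cov (lin4_translate (shiftK_unitKInvStep j) c hXcov) μ ν (Sum.inl α) (Sum.inl β) y, ← zmode_one,
    zmode_one_lin4_step hLc j c hX hδ hXcov]

/-- **CELL FORM AT ANY PERIOD** [folklore]: `zmode N (lin4 c K♮_j Lc X) μ ν (inl α) (inl β) = N^{d+1} ·` the `j`-free right-hand side
(`ZeroModeCoarseCount.zmode_eq_pow_mul_zmode_one` for the `1`-covariant coarse output). -/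
theorem zmode_lin4_step (hLc : 1 ≤ Lc) (N j : ℕ) (c : ℝ) {X : Tab d} {CT δ : ℝ} (hX : LocStencil₂ X CT δ) (hδ : 0 < δ)
    (hXcov : ∀ κ u κ' u' t, X κ (u + (Lc : ℤ) • t) κ' (u' + (Lc : ℤ) • t) = shiftK (-((Lc : ℤ) • t)) (X κ u κ' u'))
    (μ ν α β : Fin (d + 1)) :
    zmode N (lin4 c (unitK (sfStep Lc j) (smStep d Lc j) (KInvStep (d := d) Lc j)) Lc X) μ ν (Sum.inl α) (Sum.inl β)
      = ((N : ℝ) ^ (d + 1)) * (c * ((1 / 2 : ℝ) * (((Lc : ℝ) ^ (d + 1 + 1))⁻¹) ^ 4) *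
          (zmode Lc X μ ν (Sum.inl α) (Sum.inl β) + zmode Lc X ν μ (Sum.inl α) (Sum.inl β))) := by
  rw [zmode_eq_pow_mul_zmode_one N (lin4_translate (shiftK_unitKInvStep j) c hXcov) μ ν (Sum.inl α) (Sum.inl β),
    zmode_one_lin4_step hLc j c hX hδ hXcov]

/-- **HENCE THE MAP DIFFERENCE `(𝒜_i − 𝒜_j) X` IS POINTWISE ZERO-MODE-FREE** [folklore]: for every `LocStencil₂` jointly `Lc`-covariant `X`
and all steps `i, j`, `Σ'_{y′x′z′} (lin4 c K♮_i Lc X − lin4 c K♮_j Lc X) μ y ν y′ x′ z′ (inl α) (inl β) = 0` — NO pin, NO hypothesis on the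
charge of `X` (contrast ROW W3-F4d). -/
theorem inner_lin4_sub_lin4_step (hLc : 1 ≤ Lc) (i j : ℕ) (c : ℝ) {X : Tab d} {CT δ : ℝ} (hX : LocStencil₂ X CT δ) (hδ : 0 < δ)
    (hXcov : ∀ κ u κ' u' t, X κ (u + (Lc : ℤ) • t) κ' (u' + (Lc : ℤ) • t) = shiftK (-((Lc : ℤ) • t)) (X κ u κ' u'))
    (μ : Fin (d + 1)) (y : Fin (d + 1) → ℤ) (ν α β : Fin (d + 1)) :
    (∑' y', ∑' x', ∑' z',
        (lin4 c (unitK (sfStep Lc i) (smStep d Lc i) (KInvStep (d := d) Lc i)) Lc X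
          - lin4 c (unitK (sfStep Lc j) (smStep d Lc j) (KInvStep (d := d) Lc j)) Lc X) μ y ν y' x' z' (Sum.inl α) (Sum.inl β)) = 0 := by
  obtain ⟨mi, Ci, hmi, hCi, hKi⟩ := decays_KInvStep (Lc := Lc) (d := d) i
  obtain ⟨mj, Cj, hmj, hCj, hKj⟩ := decays_KInvStep (Lc := Lc) (d := d) j
  have hLi := locStencil₂_lin4 (decays_unitK (sf := sfStep Lc i) (sm := smStep d Lc i) hKi) (by positivity) hmi hLc c hX hδ
  have hLj := locStencil₂_lin4 (decays_unitK (sf := sfStep Lc j) (sm := smStep d Lc j) hKj) (by positivity) hmj hLc c hX hδ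
  rw [inner_sub_of_locStencil₂ hLi (by positivity) hLj (by positivity), inner_lin4_step hLc i c hX hδ hXcov,
    inner_lin4_step hLc j c hX hδ hXcov, sub_self]

/-- **… AND CELL ZERO-MODE-FREE AT EVERY PERIOD** [folklore]: `zmode N (lin4 c K♮_i Lc X − lin4 c K♮_j Lc X) μ ν (inl α) (inl β) = 0`. -/
theorem zmode_lin4_sub_lin4_step (hLc : 1 ≤ Lc) (N i j : ℕ) (c : ℝ) {X : Tab d} {CT δ : ℝ} (hX : LocStencil₂ X CT δ) (hδ : 0 < δ)
    (hXcov : ∀ κ u κ' u' t, X κ (u + (Lc : ℤ) • t) κ' (u' + (Lc : ℤ) • t) = shiftK (-((Lc : ℤ) • t)) (X κ u κ' u'))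
    (μ ν α β : Fin (d + 1)) :
    zmode N (lin4 c (unitK (sfStep Lc i) (smStep d Lc i) (KInvStep (d := d) Lc i)) Lc X
        - lin4 c (unitK (sfStep Lc j) (smStep d Lc j) (KInvStep (d := d) Lc j)) Lc X) μ ν (Sum.inl α) (Sum.inl β) = 0 :=
  zmode_eq_zero_of_inner_eq_zero N fun y => inner_lin4_sub_lin4_step hLc i j c hX hδ hXcov μ y ν α β

end Core


end Summit.QuantumFields.BalabanUV.Beta.GAN24.Lin4ZeroMode

end
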